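import Literature.AlgebraicGeometry.FundamentalGroup.RiemannExistenceCharPoly
import Literature.AlgebraicGeometry.FundamentalGroup.RiemannExistenceCoveringProofs
import Literature.NumberTheory.Transcendental.AnalytificationClosure
import Mathlib.RingTheory.Radical.Basic
import Mathlib.RingTheory.Polynomial.GaussLemma
import Mathlib.FieldTheory.Perfect
import Mathlib.AlgebraicGeometry.Morphisms.ClosedImmersion
import HarnessLib

/-!
# Riemann's existence theorem: continuous functions algebraic over the regular functions are regular

Topic `Literature/AlgebraicGeometry/FundamentalGroup`; proof file continuing
`RiemannExistenceCharPoly.lean` (the algebraisation step of SGA1 XII Thm. 5.1). That file shows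
that a finite covering `q : T → X(ℂ)` is finite étale algebraic as soon as its sheets are separated
by continuous functions `h` whose fibrewise characteristic polynomials have REGULAR coefficients.
This file supplies the dictionary «continuous + algebraic ⇒ regular» by which such coefficients are
recognised:

* `CharPolyRegular.exists_eval_eq_of_continuousOn_of_root` — **Theorem.** Let `X` be an INTEGRAL
  scheme, separated and locally of finite type over `ℂ`, `U ⊆ X` a non-empty affine open with
  `Γ(X, U)` integrally closed (e.g. `X` normal, or smooth over `ℂ`), `g : X(ℂ) → ℂ` continuous on
  `U(ℂ)` (strong topology) and `S ∈ Γ(X, U)[τ]` MONIC with `S(P)(g(P)) = 0` for every `P ∈ U(ℂ)`.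
  Then `g` is a regular function on `U`: there is `b ∈ Γ(X, U)` with `b(P) = g(P)` for all
  `P ∈ U(ℂ)`.

Proof (the classical argument that a continuous branch of an algebraic function is single-valued,
i.e. rational, and an everywhere-defined rational function integral over a normal ring is regular):

1. (`exists_monic_resDeriv_ne_zero_dvd_pow`) Replacing `S` by the square-free part of `S` over the
   fraction field `K` (Mathlib `UniqueFactorizationMonoid.radical`; it has coefficients in the
   integrally closed `Γ(X, U)` by Gauss's lemma, `IsIntegrallyClosed.eq_map_mul_C_of_dvd`, and the
   same complex roots fibrewise since `S ∣ S_red^n`), we may assume `S` separable over `K`, i.e.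
   `δ = Res(S, S') ≠ 0` in `Γ(X, U)`.
2. (`exists_eval_eq_of_isUnit_resDeriv`) Over the affine open `V = D(δ)`, `Z = Spec Γ(X, V)[τ]/(S)`
   is finite étale over `V` (`CharPoly.Y`, standard étale) and `P ↦ (P, g(P))` is a continuous
   SECTION `σ` of `Z(ℂ) → V(ℂ)` (`CharPoly.exists_continuous_section_Y`). Its image is open (`σ` is a
   local homeomorphism, `g(ℂ)` being one: `isLocalHomeomorph_map_of_etale`) and closed (`Z(ℂ)` is
   Hausdorff), hence the set of complex points of a clopen `W ⊆ Z` (SGA1 XII Cor. 2.6,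
   `ComplexPoints.exists_isClopen_setOf_pt_mem_eq`); `W → V` is finite étale and bijective on
   complex points, hence an isomorphism (`isIso_of_isFinite_of_etale_of_bijective`), and the
   coordinate `τ̄` pulled back along its inverse is a regular function `b_V ∈ Γ(X, V)` with
   `b_V(P) = g(P)` on `V(ℂ)`.
3. (the theorem) `S(b_V) ∈ Γ(X, V)` vanishes at every complex point, hence is `0` (`X` reduced and
   Jacobson, `eq_zero_of_forall_eval_eq_zero`), so `b_V ∈ Γ(X, U)[1/δ]` is integral over
   `Γ(X, U)`, hence `b_V = b|_V` for some `b ∈ Γ(X, U)` (integrally closed); finally `b(P) = g(P)` on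
   all of `U(ℂ)` because both sides are continuous and `V(ℂ)` is dense in `U(ℂ)` for the strong
   topology (SGA1 XII Prop. 2.2, the tree's `ComplexPoints.preimage_pt_closure_eq`).

Consequence for Riemann existence (`exists_charPoly_of_…` is left to the sequel): the fibrewise
elementary symmetric functions of a continuous `h : T → ℂ` INTEGRAL over `Γ(X, U)` along a finite
covering `q` are continuous and integral, hence regular, so the characteristic polynomial of `h` is
a monic REGULAR polynomial — the hypothesis of `CharPoly.exists_finite_etale_homeomorph_of_charPoly`.

## References

* [SGA1] A. Grothendieck, M. Raynaud, *SGA 1* (LNM 224 / arXiv:math/0206203), Exp. I Thm. 7.6,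
  Prop. 10.1 («un schéma étale et séparé sur un schéma normal connexe est intègre» pattern);
  Exp. XII Prop. 2.2, Cor. 2.6, Prop. 3.1 (iii), Thm. 5.1 (p. 333; proof, part 2).
* [StacksProject] The Stacks Project, Tag 00UE (standard étale algebras, as used in
  `RiemannExistenceCharPoly.lean`); Gauss's lemma over normal domains is Mathlib's
  `IsIntegrallyClosed.eq_map_mul_C_of_dvd`.
* J.-P. Serre, *Géométrie algébrique et géométrie analytique*, Ann. Inst. Fourier 6 (1956), §2 n° 7
  Prop. 5 (Zariski-dense opens are dense in the strong topology). [SerreGAGA1956]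

#harness_tags algebraic_geometry.etale, algebraic_geometry.sga1, complex_geometry.riemann_existence
-/

noncomputable section

open CategoryTheory AlgebraicGeometry Polynomial
open _root_.Topology

namespace Literature.AlgebraicGeometry.FundamentalGroup

open Literature.AlgebraicGeometry.Motives Literature.AlgebraicGeometry.Motives.AlgPoints

namespace CharPolyRegular

/-! ### Step 1 (algebra): the square-free part of a monic polynomial over a normal domain -/

section Algebra

/-- **Separable ⟺ `δ ≠ 0`** over a field of characteristic `0`, for `Q` monic (`δ = Res(Q, Q')`,
`CharPoly.resDeriv`; Mathlib `Polynomial.isUnit_resultant_iff_isCoprime`). [folklore] -/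
theorem resDeriv_ne_zero_iff_separable {K : Type*} [Field K] [CharZero K] {Q : K[X]}
    (hQ : Q.Monic) : CharPoly.resDeriv Q ≠ 0 ↔ Q.Separable := by
  rw [CharPoly.resDeriv_eq_resultant, ← isUnit_iff_ne_zero, isUnit_resultant_iff_isCoprime hQ,
    ← separable_def]

variable {A : Type*} [CommRing A] [IsDomain A] [IsIntegrallyClosed A] [CharZero A]

/-- **Square-free part.** For a monic `S` over an integrally closed domain `A` of characteristic
`0` there is a monic `S₁ ∈ A[τ]`, separable over the fraction field — i.e. `δ(S₁) = Res(S₁, S₁') ≠ 0`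
(`CharPoly.resDeriv`) — with `S ∣ S₁ ^ n` for some `n`: the radical of `S` in `K[τ]`
(Mathlib `UniqueFactorizationMonoid.radical`), which has coefficients in `A` by Gauss's lemma
(`IsIntegrallyClosed.eq_map_mul_C_of_dvd`). [folklore] -/
theorem exists_monic_resDeriv_ne_zero_dvd_pow (S : A[X]) (hS : S.Monic) :
    ∃ S₁ : A[X], S₁.Monic ∧ CharPoly.resDeriv S₁ ≠ 0 ∧ ∃ n : ℕ, S ∣ S₁ ^ n := by
  classical
  let K := FractionRing A
  haveI : CharZero K := charZero_of_injective_algebraMap (IsFractionRing.injective A K)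
  have hinj : Function.Injective (algebraMap A K) := IsFractionRing.injective A K
  set SK := S.map (algebraMap A K) with hSK
  have hSK0 : SK ≠ 0 := (hS.map _).ne_zero
  set R := UniqueFactorizationMonoid.radical SK with hR
  have hR0 : R ≠ 0 := UniqueFactorizationMonoid.radical_ne_zero
  have hRdvd : R ∣ SK := UniqueFactorizationMonoid.radical_dvd_self
  have hRsep : R.Separable :=
    PerfectField.separable_iff_squarefree.mpr UniqueFactorizationMonoid.squarefree_radical
  obtain ⟨S₁, hS₁⟩ := IsIntegrallyClosed.eq_map_mul_C_of_dvd (K := K) hS hRdvd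
  have hc : R.leadingCoeff ≠ 0 := leadingCoeff_ne_zero.mpr hR0
  -- `S₁` is monic
  have hS₁K : (S₁.map (algebraMap A K)).Monic := by
    have h1 : (S₁.map (algebraMap A K) * C R.leadingCoeff).leadingCoeff = R.leadingCoeff := by
      rw [hS₁]
    rw [leadingCoeff_mul, leadingCoeff_C] at h1
    exact (mul_left_eq_self₀.mp h1).resolve_right hc
  have hS₁m : S₁.Monic := monic_of_injective hinj hS₁K
  -- `S₁` is separable over `K`, i.e. `δ(S₁) ≠ 0`
  have hS₁sep : (S₁.map (algebraMap A K)).Separable := by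
    refine hRsep.of_dvd ⟨C R.leadingCoeff, ?_⟩
    rw [hS₁]
  have hδ : CharPoly.resDeriv S₁ ≠ 0 := by
    intro h0
    have h1 : CharPoly.resDeriv (S₁.map (algebraMap A K)) = 0 := by
      rw [CharPoly.resDeriv_map S₁ _ hS₁m, h0, map_zero]
    exact (resDeriv_ne_zero_iff_separable hS₁K).mpr hS₁sep h1
  -- `S ∣ S₁ ^ n`
  obtain ⟨n, hn⟩ := UniqueFactorizationMonoid.exists_dvd_radical_self_pow hSK0
  refine ⟨S₁, hS₁m, hδ, n, ?_⟩
  have h2 : R ^ n = (S₁ ^ n).map (algebraMap A K) * C R.leadingCoeff ^ n := by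
    conv_lhs => rw [← hS₁]
    rw [mul_pow, Polynomial.map_pow]
  rw [← hR, h2, ((isUnit_C.mpr (IsUnit.mk0 _ hc)).pow n).dvd_mul_right] at hn
  exact (map_dvd_map _ hinj hS).mp hn

omit [IsDomain A] [IsIntegrallyClosed A] [CharZero A] in
/-- **Root transfer along `S ∣ S₁ ^ n`**: in a reduced ring, a root of `S(φ)` is a root of
`S₁(φ)`, for every ring homomorphism `φ`. [folklore] -/
theorem eval_map_eq_zero_of_dvd_pow {S S₁ : A[X]} {n : ℕ} (h : S ∣ S₁ ^ n) {B : Type*}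
    [CommRing B] [IsReduced B] (φ : A →+* B) {z : B} (hz : (S.map φ).eval z = 0) :
    (S₁.map φ).eval z = 0 := by
  obtain ⟨H, hH⟩ := h
  have h1 : ((S₁.map φ).eval z) ^ n = 0 := by
    rw [← Polynomial.eval_pow, ← Polynomial.map_pow, hH, Polynomial.map_mul, Polynomial.eval_mul, hz,
      zero_mul]
  exact IsReduced.eq_zero _ ⟨n, h1⟩

end Algebra

/-! ### Step 2 (points): characteristic zero of sections, and sections vanishing at complex points -/

section Points

variable {X : SchemeOver ℂ}

/-- `Γ(X, U)` has characteristic `0` when non-trivial: it receives the field `ℂ` (structure map of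
`X → Spec ℂ`). [folklore] -/
theorem charZero_sections (U : X.left.Opens) [Nontrivial Γ(X.left, U)] : CharZero Γ(X.left, U) :=
  let φ : ℂ →+* Γ(X.left, U) :=
    (X.hom.appLE ⊤ U le_top).hom.comp (Scheme.ΓSpecIso (.of ℂ)).inv.hom
  charZero_of_injective_ringHom φ.injective

/-- **A section of a reduced `ℂ`-scheme locally of finite type vanishing at every complex point is
zero**: its basic open set contains no closed point, hence is empty (`X` is Jacobson,
`ComplexPoints.exists_pt_mem`), and `D(s) = ∅ ⟺ s = 0` on a reduced scheme (Mathlib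
`Scheme.basicOpen_eq_bot_iff`). [cite: SGA1, Exp. XII Prop. 2.1 (i)] -/
theorem eq_zero_of_forall_eval_eq_zero [LocallyOfFiniteType X.hom] [IsReduced X.left]
    {U : X.left.Opens} (s : Γ(X.left, U))
    (hs : ∀ (P : ComplexPoints X) (hP : P.pt ∈ U), P.eval U hP s = 0) : s = 0 := by
  rw [← AlgebraicGeometry.basicOpen_eq_bot_iff]
  by_contra hne
  have hne' : ((X.left.basicOpen s : X.left.Opens) : Set X.left).Nonempty := by
    rw [Set.nonempty_iff_ne_empty]
    exact fun h ↦ hne (TopologicalSpace.Opens.coe_eq_empty.mp h)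
  obtain ⟨P, hP⟩ := ComplexPoints.exists_pt_mem hne' (X.left.basicOpen s).isOpen.isLocallyClosed
  exact (pt_mem_basicOpen_iff P (X.left.basicOpen_le s hP) s).mp hP (hs P _)

end Points

/-! ### Step 3: a continuous root of a separable monic polynomial over `V` is regular on `V` -/

section Section

variable {X : SchemeOver ℂ} [IsSeparated X.hom] [LocallyOfFiniteType X.hom] {V : X.left.Opens}
  (hV : IsAffineOpen V) (S : Γ(X.left, V)[X]) (hS : S.Monic) (hu : IsUnit (CharPoly.resDeriv S))
  (g : ComplexPoints X → ℂ) (hg : ContinuousOn g {P | P.pt ∈ V})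
  (hroot : ∀ (P : ComplexPoints X) (hP : P.pt ∈ V), (S.map (P.evalRingHom V hP)).eval (g P) = 0)

omit [IsSeparated X.hom] [LocallyOfFiniteType X.hom] in
include hS hu hg hroot in
/-- **The continuous section `P ↦ (P, g(P))` of `Z(ℂ) → V(ℂ)`**, `Z = Spec Γ(X, V)[τ]/(S)`
(`CharPoly.exists_continuous_section_Y`). [cite: SGA1, Exp. XII Prop. 3.1 (iii)] -/
theorem exists_section :
    ∃ σ : ↥{P : ComplexPoints X | P.pt ∈ V} → ComplexPoints (CharPoly.Y hV S), Continuous σ ∧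
      (∀ P, AlgPoints.map (CharPoly.g hV S) (σ P) = P.1) ∧ ∀ P, CharPoly.xval hV S (σ P) = g P.1 :=
  CharPoly.exists_continuous_section_Y hV S hS hu (S := ↥{P : ComplexPoints X | P.pt ∈ V})
    Subtype.val continuous_subtype_val (fun P ↦ P.2) ⟨fun P ↦ g P.1, hg.restrict⟩
    fun P ↦ hroot P.1 P.2

omit [LocallyOfFiniteType X.hom] in
include hS in
/-- `Y.hom` is separated (bookkeeping). [folklore] -/
theorem isSeparated_Y_hom : IsSeparated (CharPoly.Y hV S).hom := by
  haveI := CharPoly.isFinite_toU hV S hS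
  have h1 : IsSeparated (X := Spec (.of (AdjoinRoot S))) ((CharPoly.toU hV S ≫ V.ι) ≫ X.hom) :=
    inferInstance
  exact h1

omit [IsSeparated X.hom] in
include hS in
/-- `Y.hom` is locally of finite type (bookkeeping). [folklore] -/
theorem locallyOfFiniteType_Y_hom : LocallyOfFiniteType (CharPoly.Y hV S).hom := by
  haveI := CharPoly.isFinite_toU hV S hS
  have h1 : LocallyOfFiniteType (X := Spec (.of (AdjoinRoot S)))
      ((CharPoly.toU hV S ≫ V.ι) ≫ X.hom) := inferInstance
  exact h1

omit [LocallyOfFiniteType X.hom] in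
include hS hu in
/-- **The image of a continuous section of `Z(ℂ) → V(ℂ)` is clopen in `Z(ℂ)`**: open because the
section, like `g_Z(ℂ)` (`isLocalHomeomorph_map_of_etale`), is a local homeomorphism
(`IsLocalHomeomorph.of_comp`); closed as a fixed-point set in the Hausdorff `Z(ℂ)`.
[cite: SGA1, Exp. XII Prop. 3.1 (iii) and (viii)] -/
theorem isClopen_range_section {σ : ↥{P : ComplexPoints X | P.pt ∈ V} → ComplexPoints (CharPoly.Y hV S)}
    (hσc : Continuous σ) (hσmap : ∀ P, AlgPoints.map (CharPoly.g hV S) (σ P) = P.1) :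
    IsClopen (Set.range σ) := by
  haveI := CharPoly.etale_g_left hV S hS hu
  haveI := isSeparated_Y_hom hV S hS
  haveI : T2Space (ComplexPoints (CharPoly.Y hV S)) := ComplexPoints.t2Space_of_isSeparated _
  let ρ : ComplexPoints (CharPoly.Y hV S) → ↥{P : ComplexPoints X | P.pt ∈ V} :=
    fun z ↦ ⟨AlgPoints.map (CharPoly.g hV S) z, CharPoly.pt_map_g_mem hV S z⟩
  have hρ : Continuous ρ := (AlgPoints.continuous_map _).subtype_mk _
  have hρσ : ∀ P, ρ (σ P) = P := fun P ↦ Subtype.ext (hσmap P)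
  constructor
  · -- closed: `range σ = {z | σ (ρ z) = z}`
    have heq : Set.range σ = {z | σ (ρ z) = z} := by
      ext z
      constructor
      · rintro ⟨P, rfl⟩
        change σ (ρ (σ P)) = σ P
        rw [hρσ]
      · exact fun hz ↦ ⟨_, hz⟩
    rw [heq]
    exact isClosed_eq (hσc.comp hρ) continuous_id
  · -- open: `σ` is a local homeomorphism
    have hcomp : IsLocalHomeomorph (AlgPoints.map (CharPoly.g hV S) ∘ σ) := by
      have h1 : AlgPoints.map (CharPoly.g hV S) ∘ σ = Subtype.val := funext hσmap
      rw [h1]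
      exact (AlgPoints.isOpen_setOf_pt_mem V).isOpenEmbedding_subtypeVal.isLocalHomeomorph
    exact (IsLocalHomeomorph.of_comp hcomp (isLocalHomeomorph_map_of_etale _) hσc).isOpenMap
      |>.isOpen_range

omit [IsSeparated X.hom] [LocallyOfFiniteType X.hom] in
/-- Evaluation of a global section `t` of the open subscheme `V` at one of its complex points `y`,
read through `ι_V : V ↪ X` (`ι_V^*` on `ι_V(⊤)` is a restriction map of `X`). [folklore] -/
theorem eval_ι_app_image_top (y : ComplexPoints (openSubschemeOver X V))
    (h : y.pt ∈ V.ι ⁻¹ᵁ (V.ι ''ᵁ ⊤)) (t : Γ((openSubschemeOver X V).left, ⊤)) :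
    y.eval (V.ι ⁻¹ᵁ (V.ι ''ᵁ ⊤)) h (V.ι.app (V.ι ''ᵁ ⊤) t) = y.eval ⊤ trivial t := by
  have h1 : V.ι.app (V.ι ''ᵁ ⊤) t =
      (V : Scheme).presheaf.map (homOfLE (le_top : V.ι ⁻¹ᵁ (V.ι ''ᵁ ⊤) ≤ ⊤)).op t := by
    rw [Scheme.Opens.ι_app, Scheme.Opens.toScheme_presheaf_map]
    exact congrArg (fun i ↦ (X.left.presheaf.map (Quiver.Hom.op i)) t) (Subsingleton.elim _ _)
  rw [h1]
  exact AlgPoints.eval_res y (U := ⊤) (V := V.ι ⁻¹ᵁ (V.ι ''ᵁ ⊤)) le_top h t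

set_option maxHeartbeats 400000 in
include hV hS hu hg hroot in
/-- **A continuous root of a monic `S ∈ Γ(X, V)[τ]` with `δ(S)` a unit is a regular function on
`V`.** With `σ` the section `P ↦ (P, g(P))` of `Z(ℂ) → V(ℂ)`, `Z = Spec Γ(X, V)[τ]/(S)` finite
étale over `V`: the image of `σ` is clopen, hence `W(ℂ)` for a clopen `W ⊆ Z` (SGA1 XII Cor. 2.6,
`ComplexPoints.exists_isClopen_setOf_pt_mem_eq`); `W → V` is finite étale and bijective on
complex points, hence an isomorphism (`isIso_of_isFinite_of_etale_of_bijective`), and `b` is the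
coordinate `τ̄` pulled back along `V ≅ W ⊆ Z`.
[cite: SGA1, Exp. XII Cor. 2.6 and Thm. 5.1 (proof)] -/
theorem exists_eval_eq_of_isUnit_resDeriv :
    ∃ b : Γ(X.left, V), ∀ (P : ComplexPoints X) (hP : P.pt ∈ V), P.eval V hP b = g P := by
  obtain ⟨σ, hσc, hσmap, hσx⟩ := exists_section hV S hS hu g hg hroot
  haveI := CharPoly.etale_g_left hV S hS hu
  haveI := CharPoly.isFinite_toU hV S hS
  haveI := CharPoly.etale_toU hV S hS hu
  haveI := locallyOfFiniteType_Y_hom hV S hS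
  -- the clopen `W ⊆ Z` with `W(ℂ) = range σ`
  obtain ⟨W, hW, hWσ⟩ := ComplexPoints.exists_isClopen_setOf_pt_mem_eq (X := CharPoly.Y hV S)
    (isClopen_range_section hV S hS hu hσc hσmap)
  let WO : (CharPoly.Y hV S).left.Opens := ⟨W, hW.isOpen⟩
  have hmemW : ∀ z : ComplexPoints (CharPoly.Y hV S), z.pt ∈ WO ↔ z ∈ Set.range σ := fun z ↦ by
    rw [← hWσ]; rfl
  -- `w : Z|_W ⟶ X|_V` over `ℂ`
  let w : openSubschemeOver (CharPoly.Y hV S) WO ⟶ openSubschemeOver X V :=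
    Over.homMk (WO.ι ≫ CharPoly.toU hV S) (by
      change (WO.ι ≫ CharPoly.toU hV S) ≫ V.ι ≫ X.hom = WO.ι ≫ (CharPoly.toU hV S ≫ V.ι) ≫ X.hom
      simp only [Category.assoc])
  have hwι : w ≫ openSubschemeOverι X V = openSubschemeOverι (CharPoly.Y hV S) WO ≫ CharPoly.g hV S := by
    ext1
    change (WO.ι ≫ CharPoly.toU hV S) ≫ V.ι = WO.ι ≫ (CharPoly.toU hV S ≫ V.ι)
    rw [Category.assoc]
  -- `w` is finite étale
  haveI : IsClosedImmersion WO.ι := IsClosedImmersion.of_isPreimmersion _ (by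
    rw [Scheme.Opens.range_ι]; exact hW.isClosed)
  haveI : IsFinite (X := (CharPoly.Y hV S).left) (Y := (V : Scheme)) (CharPoly.toU hV S) :=
    CharPoly.isFinite_toU hV S hS
  haveI : Etale (X := (CharPoly.Y hV S).left) (Y := (V : Scheme)) (CharPoly.toU hV S) :=
    CharPoly.etale_toU hV S hS hu
  haveI : IsFinite w.left := by
    have h1 : IsFinite (WO.ι ≫ (CharPoly.toU hV S : (CharPoly.Y hV S).left ⟶ (V : Scheme))) :=
      inferInstance
    exact h1
  haveI : Etale w.left := by
    have h1 : Etale (WO.ι ≫ (CharPoly.toU hV S : (CharPoly.Y hV S).left ⟶ (V : Scheme))) :=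
      inferInstance
    exact h1
  -- `w` is bijective on complex points
  let pW := ZariskiLocal.pointsHomeomorph (CharPoly.Y hV S) WO
  let pV := ZariskiLocal.pointsHomeomorph X V
  have hkey : ∀ z', (pV (AlgPoints.map w z')).1 = AlgPoints.map (CharPoly.g hV S) (pW z').1 := by
    intro z'
    rw [ZariskiLocal.pointsHomeomorph_apply_coe, ZariskiLocal.pointsHomeomorph_apply_coe,
      ← AlgPoints.map_comp_apply, hwι, AlgPoints.map_comp_apply]
  have hrange : ∀ z', (pW z').1 ∈ Set.range σ := fun z' ↦ (hmemW _).mp (pW z').2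
  have hbij : Function.Bijective (AlgPoints.map w :
      ComplexPoints (openSubschemeOver (CharPoly.Y hV S) WO) → ComplexPoints (openSubschemeOver X V)) := by
    constructor
    · intro z₁ z₂ h12
      obtain ⟨P₁, hP₁⟩ := hrange z₁
      obtain ⟨P₂, hP₂⟩ := hrange z₂
      have h1 : P₁.1 = P₂.1 := by
        rw [← hσmap P₁, ← hσmap P₂, hP₁, hP₂, ← hkey, ← hkey, h12]
      apply pW.injective
      exact Subtype.ext (by rw [← hP₁, ← hP₂, Subtype.ext h1])
    · intro y
      let P := pV y
      have hσP : σ P ∈ {z : ComplexPoints (CharPoly.Y hV S) | z.pt ∈ WO} :=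
        (hmemW _).mpr ⟨P, rfl⟩
      refine ⟨pW.symm ⟨σ P, hσP⟩, pV.injective (Subtype.ext ?_)⟩
      rw [hkey, Homeomorph.apply_symm_apply, hσmap]
  haveI := isIso_of_isFinite_of_etale_of_bijective w hbij
  -- the regular function: `τ̄` pulled back along `V ≅ W ⊆ Z`
  let f := inv w ≫ openSubschemeOverι (CharPoly.Y hV S) WO
  let b' : Γ((openSubschemeOver X V).left, ⊤) := f.left.appTop (CharPoly.xcoord hV S)
  have hb' : ∀ y : ComplexPoints (openSubschemeOver X V),
      y.eval ⊤ trivial b' = g (pV y).1 := by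
    intro y
    -- `f(y) ∈ range σ` lies over `(pV y).1`
    have hfy : AlgPoints.map f y ∈ Set.range σ := by
      have h1 : AlgPoints.map f y = (pW (AlgPoints.map (inv w) y)).1 := by
        rw [ZariskiLocal.pointsHomeomorph_apply_coe, ← AlgPoints.map_comp_apply]
      rw [h1]
      exact hrange _
    obtain ⟨P', hP'⟩ := hfy
    have hP'1 : P'.1 = (pV y).1 := by
      rw [← hσmap P', hP', ← AlgPoints.map_comp_apply, ZariskiLocal.pointsHomeomorph_apply_coe]
      change AlgPoints.map ((inv w ≫ openSubschemeOverι (CharPoly.Y hV S) WO) ≫ CharPoly.g hV S) y = _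
      rw [Category.assoc, ← hwι, IsIso.inv_hom_id_assoc]
    have h2 : y.eval ⊤ trivial b' = CharPoly.xval hV S (AlgPoints.map f y) := by
      change _ = (AlgPoints.map f y).eval ⊤ trivial (CharPoly.xcoord hV S)
      rw [AlgPoints.eval_map]
      rfl
    rw [h2, ← hP', hσx, hP'1]
  -- transport `b'` from `Γ(V, ⊤) = Γ(X, V.ι(⊤))` to `Γ(X, V)`
  refine ⟨X.left.presheaf.map (homOfLE V.ι_image_top.ge).op b', fun P hP ↦ ?_⟩
  let y := pV.symm ⟨P, hP⟩
  have hPy : (pV y).1 = P := by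
    change (pV (pV.symm ⟨P, hP⟩)).1 = P
    rw [Homeomorph.apply_symm_apply]
  rw [eval_res]
  conv_rhs => rw [← hPy]
  rw [← hb' y]
  -- evaluate `b'` at `y` through `ι_V`
  have key : ∀ (Q : ComplexPoints X) (_ : Q = AlgPoints.map (openSubschemeOverι X V) y)
      (h₁ : Q.pt ∈ V.ι ''ᵁ ⊤), Q.eval (V.ι ''ᵁ ⊤) h₁ b' = y.eval ⊤ trivial b' := by
    rintro _ rfl h₁
    rw [AlgPoints.eval_map]
    exact eval_ι_app_image_top y h₁ b'
  exact key P (ZariskiLocal.map_pointsHomeomorph_symm X V ⟨P, hP⟩).symm _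

end Section

/-! ### Step 4: the theorem -/

section Main

variable {X : SchemeOver ℂ} [IsSeparated X.hom] [LocallyOfFiniteType X.hom] [IsIntegral X.left]

/-- **A continuous function algebraic over the regular functions of a normal variety is regular.**
Let `X` be an integral scheme, separated and locally of finite type over `ℂ`, `U ⊆ X` a non-empty
affine open with `Γ(X, U)` integrally closed, `g : X(ℂ) → ℂ` continuous on `U(ℂ)` for the strong
topology, and `S ∈ Γ(X, U)[τ]` monic with `S(P)(g(P)) = 0` for all `P ∈ U(ℂ)`. Then there is
`b ∈ Γ(X, U)` with `b(P) = g(P)` for all `P ∈ U(ℂ)`. (Steps 1–3 of the module docstring: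
square-free part `S₁` of `S`, `δ = Res(S₁, S₁') ≠ 0`; on `V = D(δ)` the continuous root `g` is a
regular function `b_V` (`exists_eval_eq_of_isUnit_resDeriv`); `S₁(b_V) = 0` as it vanishes at all
complex points, so `b_V ∈ Γ(X, U)[1/δ]` is integral over the integrally closed `Γ(X, U)`, i.e.
`b_V = b|_V`; and `b = g` on `U(ℂ)` by continuity, `V(ℂ)` being dense in `U(ℂ)` — SGA1 XII
Prop. 2.2.) [folklore] — the function-theoretic form of the algebraisation step in the proof of
Riemann's existence theorem [cite: SGA1, Exp. XII Thm. 5.1 (p. 333), proof, part 2], with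
ingredients [cite: SGA1, Exp. XII Prop. 2.2 and Cor. 2.6]. -/
theorem exists_eval_eq_of_continuousOn_of_root {U : X.left.Opens} (hU : IsAffineOpen U)
    (hUne : (U : Set X.left).Nonempty) (hA : IsIntegrallyClosed Γ(X.left, U))
    (S : Γ(X.left, U)[X]) (hS : S.Monic) (g : ComplexPoints X → ℂ)
    (hg : ContinuousOn g {P | P.pt ∈ U})
    (hroot : ∀ (P : ComplexPoints X) (hP : P.pt ∈ U), (S.map (P.evalRingHom U hP)).eval (g P) = 0) :
    ∃ b : Γ(X.left, U), ∀ (P : ComplexPoints X) (hP : P.pt ∈ U), P.eval U hP b = g P := by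
  classical
  haveI : Nonempty U := let ⟨x, hx⟩ := hUne; ⟨⟨x, hx⟩⟩
  haveI : IsDomain Γ(X.left, U) := inferInstance
  haveI : CharZero Γ(X.left, U) := charZero_sections U
  haveI := hA
  -- Step 1: square-free part
  obtain ⟨S₁, hS₁, hδ, n, hn⟩ := exists_monic_resDeriv_ne_zero_dvd_pow S hS
  have hroot₁ : ∀ (P : ComplexPoints X) (hP : P.pt ∈ U),
      (S₁.map (P.evalRingHom U hP)).eval (g P) = 0 :=
    fun P hP ↦ eval_map_eq_zero_of_dvd_pow hn _ (hroot P hP)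
  -- the affine open `V = D(δ) ⊆ U`, over which `S₁` becomes separable
  set δ := CharPoly.resDeriv S₁ with hδdef
  let V : X.left.Opens := X.left.basicOpen δ
  have hV : IsAffineOpen V := hU.basicOpen δ
  have hVU : V ≤ U := X.left.basicOpen_le δ
  haveI : IsLocalization.Away δ Γ(X.left, V) := hU.isLocalization_basicOpen δ
  have halg : ∀ a : Γ(X.left, U),
      algebraMap Γ(X.left, U) Γ(X.left, V) a = X.left.presheaf.map (homOfLE hVU).op a :=
    fun _ ↦ rfl
  let S₂ : Γ(X.left, V)[X] := S₁.map (algebraMap Γ(X.left, U) Γ(X.left, V))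
  have hS₂ : S₂.Monic := hS₁.map _
  have hu₂ : IsUnit (CharPoly.resDeriv S₂) := by
    change IsUnit (CharPoly.resDeriv (S₁.map (algebraMap Γ(X.left, U) Γ(X.left, V))))
    rw [CharPoly.resDeriv_map S₁ _ hS₁]
    exact IsLocalization.Away.algebraMap_isUnit δ
  have hcomp : ∀ (P : ComplexPoints X) (hP : P.pt ∈ V),
      (P.evalRingHom V hP).comp (algebraMap Γ(X.left, U) Γ(X.left, V)) = P.evalRingHom U (hVU hP) := by
    intro P hP
    ext a
    rw [RingHom.comp_apply, halg, evalRingHom_apply, evalRingHom_apply, eval_res]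
  have hgV : ContinuousOn g {P | P.pt ∈ V} := hg.mono fun P hP ↦ hVU hP
  have hroot₂ : ∀ (P : ComplexPoints X) (hP : P.pt ∈ V),
      (S₂.map (P.evalRingHom V hP)).eval (g P) = 0 := by
    intro P hP
    change ((S₁.map (algebraMap Γ(X.left, U) Γ(X.left, V))).map (P.evalRingHom V hP)).eval (g P) = 0
    rw [Polynomial.map_map, hcomp P hP]
    exact hroot₁ P (hVU hP)
  -- Step 2: `g` is regular on `V`
  obtain ⟨bV, hbV⟩ := exists_eval_eq_of_isUnit_resDeriv hV S₂ hS₂ hu₂ g hgV hroot₂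
  -- Step 3a: `S₁(b_V) = 0`, so `b_V` is integral over `Γ(X, U)`
  have hS₂bV : S₂.eval bV = 0 := by
    refine eq_zero_of_forall_eval_eq_zero (X := X) _ fun P hP ↦ ?_
    rw [← evalRingHom_apply, ← Polynomial.eval₂_hom, ← Polynomial.eval_map, evalRingHom_apply,
      hbV P hP]
    exact hroot₂ P hP
  have hint : IsIntegral Γ(X.left, U) bV := ⟨S₁, hS₁, by rwa [Polynomial.eval₂_eq_eval_map]⟩
  -- Step 3b: `b_V = b|_V` with `b ∈ Γ(X, U)` (integrally closed)
  let K := FractionRing Γ(X.left, U)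
  have hδK : IsUnit (algebraMap Γ(X.left, U) K δ) :=
    isUnit_iff_ne_zero.mpr ((map_ne_zero_iff _ (IsFractionRing.injective Γ(X.left, U) K)).mpr hδ)
  let ψ : Γ(X.left, V) →ₐ[Γ(X.left, U)] K :=
    IsLocalization.Away.liftAlgHom δ (f := Algebra.ofId Γ(X.left, U) K) hδK
  obtain ⟨b, hb⟩ := IsIntegrallyClosed.algebraMap_eq_of_integral (hint.map ψ)
  have hbV' : algebraMap Γ(X.left, U) Γ(X.left, V) b = bV := by
    obtain ⟨m, hm⟩ : ∃ m : ℕ, ∃ a : Γ(X.left, U),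
        bV * algebraMap Γ(X.left, U) Γ(X.left, V) (δ ^ m) = algebraMap Γ(X.left, U) Γ(X.left, V) a :=
      ⟨(IsLocalization.Away.sec δ bV).2, (IsLocalization.Away.sec δ bV).1,
        IsLocalization.Away.sec_spec δ bV⟩
    obtain ⟨a, ha⟩ := hm
    have h1 : ψ bV * algebraMap Γ(X.left, U) K (δ ^ m) = algebraMap Γ(X.left, U) K a := by
      have h2 := congrArg ψ ha
      rwa [map_mul, AlgHom.commutes, AlgHom.commutes] at h2
    rw [← hb, ← map_mul] at h1
    have h3 : b * δ ^ m = a := IsFractionRing.injective Γ(X.left, U) K h1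
    have h4 : algebraMap Γ(X.left, U) Γ(X.left, V) b * algebraMap _ _ (δ ^ m) =
        bV * algebraMap _ _ (δ ^ m) := by
      rw [← map_mul, h3, ha]
    have hu : IsUnit (algebraMap Γ(X.left, U) Γ(X.left, V) (δ ^ m)) := by
      rw [map_pow]
      exact (IsLocalization.Away.algebraMap_isUnit δ).pow m
    exact (IsUnit.mul_left_inj hu).mp h4
  refine ⟨b, ?_⟩
  -- Step 3c: `b = g` on `V(ℂ)` ...
  have hbVeq : ∀ (P : ComplexPoints X) (hP : P.pt ∈ V), P.eval U (hVU hP) b = g P := by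
    intro P hP
    rw [← hbV P hP, ← hbV', halg, eval_res]
  -- ... hence on `U(ℂ)` by density of `V(ℂ)` (SGA1 XII Prop. 2.2) and continuity
  have hVne : ((V : Set X.left)).Nonempty := by
    rw [Set.nonempty_iff_ne_empty, Ne, TopologicalSpace.Opens.coe_eq_empty]
    intro hbot
    exact hδ ((AlgebraicGeometry.basicOpen_eq_bot_iff δ).mp hbot)
  have hVd : Dense (V : Set X.left) := V.isOpen.dense hVne
  have hdense : Dense {P : ComplexPoints X | P.pt ∈ V} :=
    ComplexPoints.dense_setOf_pt_mem (X := X) (ComplexPoints.closure_setOf_pt_mem_holds (X := X)) V hVd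
  have hdense' : Dense (Subtype.val ⁻¹' {P : ComplexPoints X | P.pt ∈ V} :
      Set ↥{P : ComplexPoints X | P.pt ∈ U}) :=
    hdense.preimage (isOpen_setOf_pt_mem U).isOpenEmbedding_subtypeVal.isOpenMap
  have hc₁ : Continuous fun P : ↥{P : ComplexPoints X | P.pt ∈ U} ↦ P.1.eval U P.2 b :=
    continuous_eval_comp Subtype.val continuous_subtype_val U (fun P ↦ P.2) b
  have hc₂ : Continuous fun P : ↥{P : ComplexPoints X | P.pt ∈ U} ↦ g P.1 := hg.restrict
  have heq := Continuous.ext_on hdense' hc₁ hc₂ fun P hP ↦ hbVeq P.1 hP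
  intro P hP
  exact congrFun heq ⟨P, hP⟩

end Main

end CharPolyRegular

end Literature.AlgebraicGeometry.FundamentalGroup

end
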